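import Summits.QuantumFields.BalabanUV.Beta.E3ContactGenerator
import Summits.QuantumFields.BalabanUV.Beta.RelInvFactorSandwich
import Summits.QuantumFields.BalabanUV.Beta.SymmetrisedDressingReflection

/-!
# `BalabanUV.Beta.E3ContactFactor` — binder row D1, RULING R-D1-g28-2 FILE E2b: THE CONTACT OF THE DRESSED `e3`-REFLECTION LAW OVER A RELATIVE
# INVERSE, EVALUATED **CHART-FREE** — an3-g30's level-generic headline `E3CoDressedContact.e3OfK_bref_inl_inl_of_law'` with the engine
# `sandwich_conjV_rel` (needs `[E, X] = 0`) REPLACED by the factorisation `RelInvFactorSandwich.mm_sandwich_conjV_diagK` (block facts, no `E` at all),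
# and the rooted border `bhKAt ρ_c` REPLACED by an ARBITRARY border `B` read through `E3ContactGenerator.ctGenM B` — hence applicable to the (0.4)
# literal's symmetrised resolvents `Gsym j` against the shifted spread `bhKStepSh Dsh j` (border `bhK + Dsh`), where `symEc` does NOT commute with the
# contact generator (an3-g55 (R-i))

HONEST FRAMING (cell charter, verbatim): «discharging BetaPertH makes Balaban's UV stability UNCONDITIONAL — a real constructive-QFT result; it is
NOT the continuum limit and NOT the Clay problem.»  HONEST DEPENDENCY: continuum YM on T⁴ ⇐ BetaPertH ∧ nine spine estimates (0/9 proved); BetaPertH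
⇐ (D1) ∧ (D4) ∧ CAP+tail; G-an2-4 gates asym, D1 and NE2/3/4.  DERIVED cell leaf (β sub-cell, BINDER-OWNERS row D1 OWNER `b2b-balaban-beta-an2`, gen 28).
WHAT ([folklore] kernel algebra over OUR objects):
* §3 THE CHART-FREE CONTACT LAW for a spread, reflection-fixed `K` with coarse multiplier legs and a spread `𝕄` with multiplier–field block `σ·B_mf`,
  multiplier block `0`, and the BLOCK FACTS `(𝕄∘K)_fm = 0`, `(K∘𝕄)_mf = 0`, `(𝕄∘K)_mm = (K∘𝕄)_mm = 1_coarse`: the border rule `Σ_κ Σ'_w colH K L μ′ y κ w ·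
  B (L•z′) w (inr m) (inl κ) = [z′ = y ∧ m = μ′]·σ⁻¹` (`sum_tsum_colH_mul_border`), the dressed generator at coarse multiplier legs = the bare field leg
  ×`(σ·L^{d+1})⁻¹` (`dressedGenM_zsmul_inr`), the field–field block of the contact (`contactM_inl_inl`, engine = `mm_sandwich_conjV_diagK`), and the
  headline **`e3OfK_bref_inl_inl_of_lawM`** ∕ **`_of_lawM'`** (substitute `𝕄⁺`, `mmRead L K =ff= τ·𝕄⁺`): the SAME display as an3's, contact coefficient
  `γ∕(σ·L^{d+1})` (resp. `γ·τ∕(σ·L^{d+1})`), generator `ctGenM B`.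
* §4 THE LITERAL'S INSTANCE `(K, 𝕄, σ, B) := (Gsym Lc j, bhKStepSh d Lc Dsh j, stepScale d Lc j, bhK Lc + Dsh)` under (Dspr)(Dnull)(Dmm)(DG): every block
  fact from `RelInvFactorSandwich` §4, `refK` by `SymmetrisedDressingReflection.refK_coDressKSymAt_KInvStep` (`Odd Lc`) — **`e3OfK_Gsym_bref_inl_inl_of_law`**.
HONEST: discharges NOTHING of the row; (Dspr)(Dnull)(Dmm)(DG) and the level-`j` (Sr-conj) law are HYPOTHESES; root-level classes 0∕5; tables 0∕5; NOT D1,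
NOT `BetaPertH`, NOT continuum, NOT Clay.  No statement of Bałaban's papers, no `[cite:]`, no `Prop` fact, no `def`.  Provenance: β sub-cell, unit
beta-an2 gen 28, 2026-08-21 (v1); pattern of `E3CoDressedContact` §3 (an3 gen 30) with the two replacements named above; no existing file touched.
-/

noncomputable section

open Finset
open scoped BigOperators
open Literature.Probability.LatticeModels (Torus.proj)
open Literature.MathematicalPhysics.QuantumFieldTheory
open Literature.MathematicalPhysics.QuantumFieldTheory.Balaban1983to89
open Literature.MathematicalPhysics.QuantumFieldTheory.Balaban1983to89.Beta
open B12Sec2to5 (l1 l1_nonneg)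
open ExpKernelCalculus (MKer comp Decays BiLoc VertexFamily summable_exp_shift')
open PolarizationSign (reflSign)
open KernelReflection (refK)
open ResolventReflection (bref Φ)
open OneStepResolventKernel (Fib LocStencil proj_zsmul quo_zsmul)
open OneStepKernelFamily (KInvStep colH vertexOfK vertexFamily_vertexOfK' abs_colH_le)
open BalabanStepJetsSucc (mmRead mmRead_inl_inl)
open AveragingContoursRooted (ctr ctrOff ctrOff_mem_box)
open Summit.QuantumFields.BalabanUV.Beta.TameKernelCalculus
open Summit.QuantumFields.BalabanUV.Beta.ChartConjugation (conjV)
open Summit.QuantumFields.BalabanUV.Beta.AxialDressingRooted (one_le_of_neZero)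
open Summit.QuantumFields.BalabanUV.Beta.BorderedHessian (bhK bhK_inr_inr spr_bhK bhKStep bhKStep_zero bhKStep_succ_inr_inl bhKStep_succ_inr_inr
  stepScale stepScale_ne_zero diagK diagK_apply conjV_diagK_apply)
open Summit.QuantumFields.BalabanUV.Beta.SymSliceProjectorKernel (symEc)
open Summit.QuantumFields.BalabanUV.Beta.SpineRooted (e3OfK e3OfK_apply)
open Summit.QuantumFields.BalabanUV.Beta.VertexReflectionContact (smul_diagK vertexOfK_conjV_diagK)
open Summit.QuantumFields.BalabanUV.Beta.VertexSandwichTransport (sandwichLaw_ff_iff)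
open Summit.QuantumFields.BalabanUV.Beta.E3CoDressedContact (conjV_diagK_inl_inl_of_ff)
open Summit.QuantumFields.BalabanUV.Beta.SymmetrisedStepJets (Gsym Gsym_apply)
open Summit.QuantumFields.BalabanUV.Beta.SymShiftedSpread (bhKStepSh bhKStepSh_apply spr_bhKStepSh)
open Summit.QuantumFields.BalabanUV.Beta.SymmetrisedDressingReflection (refK_coDressKSymAt_KInvStep)
open Summit.QuantumFields.BalabanUV.Beta.RelInvNullShift (spr_add)
open Summit.QuantumFields.BalabanUV.Beta.KernelWardLevels (stepScale_zero)
open Summit.QuantumFields.BalabanUV.Beta.RelInvFactorSandwich (comp_apply' mm_sandwich_conjV_diagK spr_Gsym Gsym_inr_row_coarse Gsym_inr_col_coarse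
  comp_bhKStepSh_Gsym_inl_inr comp_Gsym_bhKStepSh_inr_inl comp_bhKStepSh_Gsym_inr_inr comp_Gsym_bhKStepSh_inr_inr)
open Summit.QuantumFields.BalabanUV.Beta.E3ContactGenerator (ctGenM ctGenM_inl ctGenM_inr abs_le_of_decays loc_diagK_dressedGenM
  vertexOfK_conjV_smul_diagK_ctGenM)

namespace Summit.QuantumFields.BalabanUV.Beta.E3ContactFactor

variable {d : ℕ}

/-! ## §3 The chart-free contact law from block facts -/

section LevelGeneric

variable {Lc : ℕ} [NeZero Lc] {K 𝕄 B : MKer (d + 1) (Fib d)}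

/-- [folklore] **RULE `(𝕄 ∘ K)_mm = 1_coarse` READ AGAINST THE SPREAD'S OWN BORDER.**  For spread `K`, `B`, a kernel `𝕄` with multiplier–field block
`σ·B_mf` and multiplier block `0`, and `(𝕄∘K)` the identity between coarse multiplier legs:
`Σ_κ Σ'_w colH K Lc μ′ y κ w · B (Lc•z′) w (inr m) (inl κ) = [z′ = y ∧ m = μ′]·σ⁻¹`. -/
theorem sum_tsum_colH_mul_border (hK : Spr K) (hB : Spr B) (σ : ℝ) (hσ : σ ≠ 0)
    (h𝕄mf : ∀ (x y : Fin (d + 1) → ℤ) (κ l : Fin (d + 1)), 𝕄 x y (Sum.inr κ) (Sum.inl l) = σ * B x y (Sum.inr κ) (Sum.inl l))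
    (h𝕄mm : ∀ (x y : Fin (d + 1) → ℤ) (κ l : Fin (d + 1)), 𝕄 x y (Sum.inr κ) (Sum.inr l) = 0)
    (hMKmm : ∀ (x z : Fin (d + 1) → ℤ) (m m' : Fin (d + 1)), Torus.proj Lc x = 0 → Torus.proj Lc z = 0 →
      comp 𝕄 K x z (Sum.inr m) (Sum.inr m') = if x = z ∧ m = m' then 1 else 0)
    (m μ' : Fin (d + 1)) (z' y : Fin (d + 1) → ℤ) :
    ∑ κ, ∑' w, colH K Lc μ' y κ w * B ((Lc : ℤ) • z') w (Sum.inr m) (Sum.inl κ) = if z' = y ∧ m = μ' then σ⁻¹ else 0 := by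
  classical
  obtain ⟨δK, CK, hδK, hCK, hKd⟩ := E3GenericReflection.Spr.decays' hK
  obtain ⟨δB, CB, hδB, -, hBd⟩ := E3GenericReflection.Spr.decays' hB
  have hsum : ∀ κ, Summable fun w => colH K Lc μ' y κ w * B ((Lc : ℤ) • z') w (Sum.inr m) (Sum.inl κ) := fun κ => by
    refine Summable.of_norm_bounded (((summable_exp_shift' hδK ((Lc : ℤ) • y)).mul_left CK).mul_right CB) (fun w => ?_)
    rw [Real.norm_eq_abs, abs_mul]
    exact mul_le_mul (abs_colH_le (N := Lc) hKd μ' y κ w) (abs_le_of_decays hBd hδB.le _ _ _ _) (abs_nonneg _)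
      (mul_nonneg hCK (Real.exp_pos _).le)
  have h := hMKmm ((Lc : ℤ) • z') ((Lc : ℤ) • y) m μ' (proj_zsmul _) (proj_zsmul _)
  rw [comp_apply'] at h
  simp only [Fintype.sum_sum_type, h𝕄mf, h𝕄mm, zero_mul, Finset.sum_const_zero, add_zero] at h
  have hinj : ((Lc : ℤ) • z' = (Lc : ℤ) • y) ↔ z' = y :=
    ⟨fun h' => by simpa only [quo_zsmul] using congrArg (LatticeForm.quo Lc) h', fun h' => by rw [h']⟩
  have h2 : ∑' w, ∑ κ, colH K Lc μ' y κ w * B ((Lc : ℤ) • z') w (Sum.inr m) (Sum.inl κ) = σ⁻¹ * (if (Lc : ℤ) • z' = (Lc : ℤ) • y ∧ m = μ' then 1 else 0) := by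
    rw [← h, ← tsum_mul_left]
    refine tsum_congr fun w => ?_
    rw [Finset.mul_sum]
    refine Finset.sum_congr rfl fun κ _ => ?_
    simp only [colH]
    rw [show σ⁻¹ * (σ * B ((Lc : ℤ) • z') w (Sum.inr m) (Sum.inl κ) * K w ((Lc : ℤ) • y) (Sum.inl κ) (Sum.inr μ')) =
      (σ⁻¹ * σ) * (K w ((Lc : ℤ) • y) (Sum.inl κ) (Sum.inr μ') * B ((Lc : ℤ) • z') w (Sum.inr m) (Sum.inl κ)) by ring, inv_mul_cancel₀ hσ, one_mul]
  rw [Summable.tsum_finsetSum (fun κ _ => hsum κ)] at h2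
  rw [h2]
  simp only [hinj]
  split_ifs <;> simp

/-- [folklore] **THE DRESSED GENERATOR AT A COARSE MULTIPLIER LEG IS THE BARE GENERATOR'S FIELD LEG, SCALED BY `(σ·Lc^{d+1})⁻¹`.** -/
theorem dressedGenM_zsmul_inr (hK : Spr K) (hB : Spr B) (σ : ℝ) (hσ : σ ≠ 0)
    (h𝕄mf : ∀ (x y : Fin (d + 1) → ℤ) (κ l : Fin (d + 1)), 𝕄 x y (Sum.inr κ) (Sum.inl l) = σ * B x y (Sum.inr κ) (Sum.inl l))
    (h𝕄mm : ∀ (x y : Fin (d + 1) → ℤ) (κ l : Fin (d + 1)), 𝕄 x y (Sum.inr κ) (Sum.inr l) = 0)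
    (hMKmm : ∀ (x z : Fin (d + 1) → ℤ) (m m' : Fin (d + 1)), Torus.proj Lc x = 0 → Torus.proj Lc z = 0 →
      comp 𝕄 K x z (Sum.inr m) (Sum.inr m') = if x = z ∧ m = m' then 1 else 0)
    (α μ : Fin (d + 1)) (y z' : Fin (d + 1) → ℤ) (m : Fin (d + 1)) :
    ∑ κ, ∑' u, colH K Lc μ y κ u * ctGenM d B α Lc κ u ((Lc : ℤ) • z') (Sum.inr m) =
      (σ * (Lc : ℝ) ^ (d + 1))⁻¹ * ctGenM d B α Lc μ y z' (Sum.inl m) := by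
  classical
  simp only [ctGenM_inr, ctGenM_inl]
  by_cases hm : m = α
  · simp only [hm, if_true]
    have hE := sum_tsum_colH_mul_border hK hB σ hσ h𝕄mf h𝕄mm hMKmm α μ z' y
    have e1 : ∀ κ, ∑' u, colH K Lc μ y κ u * -(((Lc : ℝ) ^ (d + 1))⁻¹ * B ((Lc : ℤ) • z') u (Sum.inr α) (Sum.inl κ)) =
        -((Lc : ℝ) ^ (d + 1))⁻¹ * ∑' u, colH K Lc μ y κ u * B ((Lc : ℤ) • z') u (Sum.inr α) (Sum.inl κ) := fun κ => by
      rw [← tsum_mul_left]; exact tsum_congr fun u => by ring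
    simp only [e1, ← Finset.mul_sum, hE]
    by_cases h2 : z' = y ∧ α = μ
    · rw [if_pos h2, if_pos ⟨h2.1, h2.2, h2.2.symm⟩, mul_inv]; ring
    · have h2' : ¬(z' = y ∧ α = μ ∧ μ = α) := fun h' => h2 ⟨h'.1, h'.2.1⟩
      rw [if_neg h2, if_neg h2', mul_zero, mul_zero]
  · have h2' : ¬(z' = y ∧ m = μ ∧ μ = α) := fun h' => hm (h'.2.1.trans h'.2.2)
    simp only [hm, if_false, mul_zero, tsum_zero, Finset.sum_const_zero, if_neg h2']

/-- [folklore] **THE FIELD–FIELD BLOCK OF THE CONTACT, CHART-FREE**: with the block facts of `RelInvFactorSandwich.mm_sandwich_conjV_diagK`,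
`(−mmRead Lc (K ∘ conjV 𝕄 (γ • diagK Gᵛ_{K,μ,y}) ∘ K)) x′ z′ (inl a) (inl b) = (γ/(σ·Lc^{d+1})) · conjV (mmRead Lc K) (diagK (ctGenM d B α Lc μ y)) x′ z′ (inl a) (inl b)`. -/
theorem contactM_inl_inl (hK : Spr K) (hM : Spr 𝕄) (hB : Spr B) (σ : ℝ) (hσ : σ ≠ 0)
    (hKrow : ∀ (x z : Fin (d + 1) → ℤ) (m : Fin (d + 1)) (b : Fib d), Torus.proj Lc x ≠ 0 → K x z (Sum.inr m) b = 0)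
    (hKcol : ∀ (x z : Fin (d + 1) → ℤ) (a : Fib d) (m : Fin (d + 1)), Torus.proj Lc z ≠ 0 → K x z a (Sum.inr m) = 0)
    (hMKfm : ∀ (x z : Fin (d + 1) → ℤ) (a m : Fin (d + 1)), comp 𝕄 K x z (Sum.inl a) (Sum.inr m) = 0)
    (hKMmf : ∀ (x z : Fin (d + 1) → ℤ) (m a : Fin (d + 1)), comp K 𝕄 x z (Sum.inr m) (Sum.inl a) = 0)
    (hMKmm : ∀ (x z : Fin (d + 1) → ℤ) (m m' : Fin (d + 1)), Torus.proj Lc x = 0 → Torus.proj Lc z = 0 →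
      comp 𝕄 K x z (Sum.inr m) (Sum.inr m') = if x = z ∧ m = m' then 1 else 0)
    (hKMmm : ∀ (x z : Fin (d + 1) → ℤ) (m m' : Fin (d + 1)), Torus.proj Lc x = 0 → Torus.proj Lc z = 0 →
      comp K 𝕄 x z (Sum.inr m) (Sum.inr m') = if x = z ∧ m = m' then 1 else 0)
    (h𝕄mf : ∀ (x y : Fin (d + 1) → ℤ) (κ l : Fin (d + 1)), 𝕄 x y (Sum.inr κ) (Sum.inl l) = σ * B x y (Sum.inr κ) (Sum.inl l))
    (h𝕄mm : ∀ (x y : Fin (d + 1) → ℤ) (κ l : Fin (d + 1)), 𝕄 x y (Sum.inr κ) (Sum.inr l) = 0)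
    (γ : ℝ) (α μ : Fin (d + 1)) (y x' z' : Fin (d + 1) → ℤ) (a b : Fin (d + 1)) :
    (-mmRead Lc (comp (comp K (conjV 𝕄 (γ • diagK (fun p c => ∑ κ, ∑' u, colH K Lc μ y κ u * ctGenM d B α Lc κ u p c)))) K))
        x' z' (Sum.inl a) (Sum.inl b) =
      γ / (σ * (Lc : ℝ) ^ (d + 1)) * conjV (mmRead Lc K) (diagK (ctGenM d B α Lc μ y)) x' z' (Sum.inl a) (Sum.inl b) := by
  have hg : Loc (diagK fun p c => γ * ∑ κ, ∑' u, colH K Lc μ y κ u * ctGenM d B α Lc κ u p c) := by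
    rw [← smul_diagK]; exact (loc_diagK_dressedGenM α hK hB μ y).smul γ
  rw [Pi.neg_apply, Pi.neg_apply, Pi.neg_apply, Pi.neg_apply, mmRead_inl_inl, smul_diagK,
    mm_sandwich_conjV_diagK hK hM _ hg hKrow hKcol hMKfm hKMmf hMKmm hKMmm, neg_neg, conjV_diagK_apply,
    dressedGenM_zsmul_inr hK hB σ hσ h𝕄mf h𝕄mm hMKmm α μ y z' b, dressedGenM_zsmul_inr hK hB σ hσ h𝕄mf h𝕄mm hMKmm α μ y x' a,
    conjV_diagK_apply, mmRead_inl_inl]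
  ring

/-- [folklore] **THE CHART-FREE LEVEL-GENERIC HEADLINE.**  Let `K` be spread with `refK (Φ Lc α) K = K` and coarse multiplier legs, `𝕄` spread with
multiplier–field block `σ·B_mf` (`σ ≠ 0`, `B` spread) and multiplier block `0`, with the block facts `(𝕄∘K)_fm = 0`, `(K∘𝕄)_mf = 0`,
`(𝕄∘K)_mm = (K∘𝕄)_mm = 1_coarse`; let the local stencil family `S` obey `S κ (bref α κ u) = ε • refK (Φ Lc α) (S κ u + conjV 𝕄 (γ • diagK (ctGenM d B α Lc κ u)))`.
Then `e3OfK Lc K S κ′ (bref α κ′ u′) =ff= ε·s_a·s_b·(e3OfK Lc K S κ′ u′ (r x) (r z) + (γ/(σ·Lc^{d+1}))·conjV (mmRead Lc K) (diagK (ctGenM d B α Lc κ′ u′)) (r x) (r z))`. -/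
theorem e3OfK_bref_inl_inl_of_lawM (hK : Spr K) {α : Fin (d + 1)} (hKr : refK (Φ (d := d) Lc α) K = K) (hM : Spr 𝕄) (hB : Spr B)
    (σ : ℝ) (hσ : σ ≠ 0)
    (hKrow : ∀ (x z : Fin (d + 1) → ℤ) (m : Fin (d + 1)) (b : Fib d), Torus.proj Lc x ≠ 0 → K x z (Sum.inr m) b = 0)
    (hKcol : ∀ (x z : Fin (d + 1) → ℤ) (a : Fib d) (m : Fin (d + 1)), Torus.proj Lc z ≠ 0 → K x z a (Sum.inr m) = 0)
    (hMKfm : ∀ (x z : Fin (d + 1) → ℤ) (a m : Fin (d + 1)), comp 𝕄 K x z (Sum.inl a) (Sum.inr m) = 0)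
    (hKMmf : ∀ (x z : Fin (d + 1) → ℤ) (m a : Fin (d + 1)), comp K 𝕄 x z (Sum.inr m) (Sum.inl a) = 0)
    (hMKmm : ∀ (x z : Fin (d + 1) → ℤ) (m m' : Fin (d + 1)), Torus.proj Lc x = 0 → Torus.proj Lc z = 0 →
      comp 𝕄 K x z (Sum.inr m) (Sum.inr m') = if x = z ∧ m = m' then 1 else 0)
    (hKMmm : ∀ (x z : Fin (d + 1) → ℤ) (m m' : Fin (d + 1)), Torus.proj Lc x = 0 → Torus.proj Lc z = 0 →
      comp K 𝕄 x z (Sum.inr m) (Sum.inr m') = if x = z ∧ m = m' then 1 else 0)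
    (h𝕄mf : ∀ (x y : Fin (d + 1) → ℤ) (κ l : Fin (d + 1)), 𝕄 x y (Sum.inr κ) (Sum.inl l) = σ * B x y (Sum.inr κ) (Sum.inl l))
    (h𝕄mm : ∀ (x y : Fin (d + 1) → ℤ) (κ l : Fin (d + 1)), 𝕄 x y (Sum.inr κ) (Sum.inr l) = 0)
    {S : Fin (d + 1) → (Fin (d + 1) → ℤ) → MKer (d + 1) (Fib d)} {Cs δ : ℝ} (hS : LocStencil S Cs δ) (hδ : 0 < δ) (γ : ℝ)
    (hSr : ∀ κ u, S κ (bref α κ u) =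
      reflSign α κ • refK (Φ (d := d) Lc α) (S κ u + conjV 𝕄 (γ • diagK (ctGenM d B α Lc κ u))))
    (κ' : Fin (d + 1)) (u' x z : Fin (d + 1) → ℤ) (a b : Fin (d + 1)) :
    e3OfK Lc K S κ' (bref α κ' u') x z (Sum.inl a) (Sum.inl b) =
      reflSign α κ' * ((Φ (d := d) Lc α).s (Sum.inl a) * (Φ (d := d) Lc α).s (Sum.inl b) *
        (e3OfK Lc K S κ' u' ((Φ (d := d) Lc α).r (Sum.inl a) x) ((Φ (d := d) Lc α).r (Sum.inl b) z) (Sum.inl a) (Sum.inl b) +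
          γ / (σ * (Lc : ℝ) ^ (d + 1)) *
            conjV (mmRead Lc K) (diagK (ctGenM d B α Lc κ' u')) ((Φ (d := d) Lc α).r (Sum.inl a) x)
              ((Φ (d := d) Lc α).r (Sum.inl b) z) (Sum.inl a) (Sum.inl b))) := by
  have hlaw := (sandwichLaw_ff_iff (N := Lc) hS hδ hSr hK hKr κ' u'
    (fun p q e f => γ / (σ * (Lc : ℝ) ^ (d + 1)) * conjV (mmRead Lc K) (diagK (ctGenM d B α Lc κ' u')) p q e f)).2
    (fun x' z' a' b' => by
      rw [vertexOfK_conjV_smul_diagK_ctGenM α hK hB 𝕄 γ κ' u']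
      exact contactM_inl_inl hK hM hB σ hσ hKrow hKcol hMKfm hKMmf hMKmm hKMmm h𝕄mf h𝕄mm γ α κ' u' x' z' a' b') x z a b
  simp only [e3OfK_apply]
  simpa only [Pi.neg_apply] using hlaw

/-- [folklore] The same with a substitute `𝕄⁺` for `mmRead Lc K` on the field block (`mmRead Lc K =ff= τ·𝕄⁺`): coefficient `γ·τ/(σ·Lc^{d+1})`. -/
theorem e3OfK_bref_inl_inl_of_lawM' (hK : Spr K) {α : Fin (d + 1)} (hKr : refK (Φ (d := d) Lc α) K = K) (hM : Spr 𝕄) (hB : Spr B)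
    (σ : ℝ) (hσ : σ ≠ 0)
    (hKrow : ∀ (x z : Fin (d + 1) → ℤ) (m : Fin (d + 1)) (b : Fib d), Torus.proj Lc x ≠ 0 → K x z (Sum.inr m) b = 0)
    (hKcol : ∀ (x z : Fin (d + 1) → ℤ) (a : Fib d) (m : Fin (d + 1)), Torus.proj Lc z ≠ 0 → K x z a (Sum.inr m) = 0)
    (hMKfm : ∀ (x z : Fin (d + 1) → ℤ) (a m : Fin (d + 1)), comp 𝕄 K x z (Sum.inl a) (Sum.inr m) = 0)
    (hKMmf : ∀ (x z : Fin (d + 1) → ℤ) (m a : Fin (d + 1)), comp K 𝕄 x z (Sum.inr m) (Sum.inl a) = 0)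
    (hMKmm : ∀ (x z : Fin (d + 1) → ℤ) (m m' : Fin (d + 1)), Torus.proj Lc x = 0 → Torus.proj Lc z = 0 →
      comp 𝕄 K x z (Sum.inr m) (Sum.inr m') = if x = z ∧ m = m' then 1 else 0)
    (hKMmm : ∀ (x z : Fin (d + 1) → ℤ) (m m' : Fin (d + 1)), Torus.proj Lc x = 0 → Torus.proj Lc z = 0 →
      comp K 𝕄 x z (Sum.inr m) (Sum.inr m') = if x = z ∧ m = m' then 1 else 0)
    (h𝕄mf : ∀ (x y : Fin (d + 1) → ℤ) (κ l : Fin (d + 1)), 𝕄 x y (Sum.inr κ) (Sum.inl l) = σ * B x y (Sum.inr κ) (Sum.inl l))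
    (h𝕄mm : ∀ (x y : Fin (d + 1) → ℤ) (κ l : Fin (d + 1)), 𝕄 x y (Sum.inr κ) (Sum.inr l) = 0)
    {S : Fin (d + 1) → (Fin (d + 1) → ℤ) → MKer (d + 1) (Fib d)} {Cs δ : ℝ} (hS : LocStencil S Cs δ) (hδ : 0 < δ) (γ : ℝ)
    (hSr : ∀ κ u, S κ (bref α κ u) =
      reflSign α κ • refK (Φ (d := d) Lc α) (S κ u + conjV 𝕄 (γ • diagK (ctGenM d B α Lc κ u))))
    {𝕄' : MKer (d + 1) (Fib d)} (τ : ℝ)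
    (h𝕄' : ∀ (x z : Fin (d + 1) → ℤ) (a b : Fin (d + 1)), mmRead Lc K x z (Sum.inl a) (Sum.inl b) = τ * 𝕄' x z (Sum.inl a) (Sum.inl b))
    (κ' : Fin (d + 1)) (u' x z : Fin (d + 1) → ℤ) (a b : Fin (d + 1)) :
    e3OfK Lc K S κ' (bref α κ' u') x z (Sum.inl a) (Sum.inl b) =
      reflSign α κ' * ((Φ (d := d) Lc α).s (Sum.inl a) * (Φ (d := d) Lc α).s (Sum.inl b) *
        (e3OfK Lc K S κ' u' ((Φ (d := d) Lc α).r (Sum.inl a) x) ((Φ (d := d) Lc α).r (Sum.inl b) z) (Sum.inl a) (Sum.inl b) +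
          γ * τ / (σ * (Lc : ℝ) ^ (d + 1)) *
            conjV 𝕄' (diagK (ctGenM d B α Lc κ' u')) ((Φ (d := d) Lc α).r (Sum.inl a) x)
              ((Φ (d := d) Lc α).r (Sum.inl b) z) (Sum.inl a) (Sum.inl b))) := by
  rw [e3OfK_bref_inl_inl_of_lawM hK hKr hM hB σ hσ hKrow hKcol hMKfm hKMmf hMKmm hKMmm h𝕄mf h𝕄mm hS hδ γ hSr κ' u' x z a b,
    conjV_diagK_inl_inl_of_ff τ h𝕄']
  ring

end LevelGeneric

/-! ## §4 The literal: `Gsym j` against the shifted spread `bhKStepSh Dsh j`, border `bhK + Dsh` -/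

section Literal

variable {Lc : ℕ} [NeZero Lc] {Dsh : MKer (d + 1) (Fib d)}

/-- [folklore] The straight step candidate has the UNIFORM multiplier–field border scale `stepScale j` (`= 1` at `j = 0`). -/
theorem bhKStep_mf_uniform : ∀ (j : ℕ) (x y : Fin (d + 1) → ℤ) (κ l : Fin (d + 1)),
    bhKStep d Lc j x y (Sum.inr κ) (Sum.inl l) = stepScale d Lc j * bhK Lc x y (Sum.inr κ) (Sum.inl l)
  | 0, x, y, κ, l => by rw [bhKStep_zero, stepScale_zero, one_mul]
  | j + 1, x, y, κ, l => bhKStep_succ_inr_inl j x y κ l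

/-- [folklore] The straight step candidate has no multiplier block at any level. -/
theorem bhKStep_mm_zero : ∀ (j : ℕ) (x y : Fin (d + 1) → ℤ) (κ l : Fin (d + 1)), bhKStep d Lc j x y (Sum.inr κ) (Sum.inr l) = 0
  | 0, x, y, κ, l => by rw [bhKStep_zero, bhK_inr_inr]
  | j + 1, x, y, κ, l => bhKStep_succ_inr_inr j x y κ l

/-- [folklore] The shifted spread's multiplier–field block is `stepScale j · (bhK + Dsh)_mf`. -/
theorem bhKStepSh_mf (j : ℕ) (x y : Fin (d + 1) → ℤ) (κ l : Fin (d + 1)) :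
    bhKStepSh d Lc Dsh j x y (Sum.inr κ) (Sum.inl l) = stepScale d Lc j * (bhK (d := d) Lc + Dsh) x y (Sum.inr κ) (Sum.inl l) := by
  rw [bhKStepSh_apply]
  simp only [Pi.add_apply, Pi.smul_apply, smul_eq_mul, bhKStep_mf_uniform]
  ring

/-- [folklore] The shifted spread has no multiplier block, under (Dmm) `Dsh_mm = 0`. -/
theorem bhKStepSh_mm (hDmm : ∀ (x y : Fin (d + 1) → ℤ) (κ l : Fin (d + 1)), Dsh x y (Sum.inr κ) (Sum.inr l) = 0) (j : ℕ)
    (x y : Fin (d + 1) → ℤ) (κ l : Fin (d + 1)) : bhKStepSh d Lc Dsh j x y (Sum.inr κ) (Sum.inr l) = 0 := by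
  rw [bhKStepSh_apply, Pi.add_apply, Pi.add_apply, Pi.add_apply, Pi.add_apply, bhKStep_mm_zero]
  simp only [Pi.smul_apply, smul_eq_mul, hDmm, mul_zero, add_zero]

/-- [folklore] **THE CUBIC-SECTOR CONTACT LAW FOR THE (0.4) LITERAL'S RESOLVENTS AT EVERY LEVEL** (RULING R-D1-g28-2): `Lc` odd; the shift `Dsh`
with (Dspr) `Spr Dsh`, (Dnull) `symEc∘Dsh∘symEc = 0`, (Dmm) `Dsh_mm = 0`, (DG) `(G_j∘Dsh)_mf = 0 ∧ (Dsh∘G_j)_fm = 0`; a local stencil family `S` obeying the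
(Sr-conj) law against `bhKStepSh d Lc Dsh j` with contact `γ • diagK (ctGenM d (bhK Lc + Dsh) α Lc κ u)`.  Then `e3OfK Lc (Gsym Lc j) S` obeys the ff-law
with contact coefficient `γ∕(stepScale d Lc j · Lc^{d+1})` against `mmRead Lc (Gsym Lc j)` and the SAME generator. -/
theorem e3OfK_Gsym_bref_inl_inl_of_law (hLc : Odd Lc) (j : ℕ) (hD : Spr Dsh) (hDnull : comp (comp (symEc Lc) Dsh) (symEc Lc) = 0)
    (hDmm : ∀ (x y : Fin (d + 1) → ℤ) (κ l : Fin (d + 1)), Dsh x y (Sum.inr κ) (Sum.inr l) = 0)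
    (hGD : ∀ (x z : Fin (d + 1) → ℤ) (m a : Fin (d + 1)), comp (Gsym (d := d) Lc j) Dsh x z (Sum.inr m) (Sum.inl a) = 0)
    (hDG : ∀ (x z : Fin (d + 1) → ℤ) (a m : Fin (d + 1)), comp Dsh (Gsym (d := d) Lc j) x z (Sum.inl a) (Sum.inr m) = 0)
    {α : Fin (d + 1)} {S : Fin (d + 1) → (Fin (d + 1) → ℤ) → MKer (d + 1) (Fib d)} {Cs δ : ℝ} (hS : LocStencil S Cs δ) (hδ : 0 < δ) (γ : ℝ)
    (hSr : ∀ κ u, S κ (bref α κ u) =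
      reflSign α κ • refK (Φ (d := d) Lc α) (S κ u + conjV (bhKStepSh d Lc Dsh j) (γ • diagK (ctGenM d (bhK Lc + Dsh) α Lc κ u))))
    (κ' : Fin (d + 1)) (u' x z : Fin (d + 1) → ℤ) (a b : Fin (d + 1)) :
    e3OfK Lc (Gsym Lc j) S κ' (bref α κ' u') x z (Sum.inl a) (Sum.inl b) =
      reflSign α κ' * ((Φ (d := d) Lc α).s (Sum.inl a) * (Φ (d := d) Lc α).s (Sum.inl b) *
        (e3OfK Lc (Gsym Lc j) S κ' u' ((Φ (d := d) Lc α).r (Sum.inl a) x) ((Φ (d := d) Lc α).r (Sum.inl b) z) (Sum.inl a) (Sum.inl b) +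
          γ / (stepScale d Lc j * (Lc : ℝ) ^ (d + 1)) *
            conjV (mmRead Lc (Gsym (d := d) Lc j)) (diagK (ctGenM d (bhK Lc + Dsh) α Lc κ' u')) ((Φ (d := d) Lc α).r (Sum.inl a) x)
              ((Φ (d := d) Lc α).r (Sum.inl b) z) (Sum.inl a) (Sum.inl b))) := by
  have hKr : refK (Φ (d := d) Lc α) (Gsym (d := d) Lc j) = Gsym Lc j := by rw [Gsym_apply]; exact refK_coDressKSymAt_KInvStep hLc j α
  have hB : Spr (bhK (d := d) Lc + Dsh) := spr_add (spr_bhK (one_le_of_neZero Lc)) hD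
  exact e3OfK_bref_inl_inl_of_lawM (spr_Gsym j) hKr (spr_bhKStepSh hD j) hB (stepScale d Lc j) (stepScale_ne_zero j)
    (fun x z m b hx => Gsym_inr_row_coarse j x z m b hx) (fun x z a m hz => Gsym_inr_col_coarse j x z a m hz)
    (comp_bhKStepSh_Gsym_inl_inr hD j hDG) (comp_Gsym_bhKStepSh_inr_inl hD j hGD)
    (fun x z m m' hx _ => comp_bhKStepSh_Gsym_inr_inr hD hDnull j x z m m' hx)
    (fun x z m m' _ hz => comp_Gsym_bhKStepSh_inr_inr hD hDnull j x z m m' hz) (bhKStepSh_mf j) (bhKStepSh_mm hDmm j) hS hδ γ hSr κ' u' x z a b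

end Literal

end Summit.QuantumFields.BalabanUV.Beta.E3ContactFactor

end
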